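import Literature.NumberTheory.EllipticCurves.Kato2004.DivisibilityInputsSplitTwistDescent
import Literature.NumberTheory.EllipticCurves.Kato2004.AdditiveNoSplitCyclotomicTwistRankZeroShaUpperBoundFineSelmerAtTwoSharp
import Literature.NumberTheory.EllipticCurves.Kato2004.MemberHullInputsTwoNoSplitTwistSharp
import Literature.NumberTheory.EllipticCurves.PAdicLFunctionMinusMultGammaTwist
import HarnessLib

/-!
# Route ByReductionTypeAtTwo, crux `AdditiveRankZeroAtTwo` (stmt-BirchSwinnertonDyer-19098), child C4″ `AdditivePotMultOverKAtTwo`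
# (stmt-BirchSwinnertonDyer-22618) — the DESCENT SOCKETS of the four split-twist blocks: the block targets
# `KatoSharpAtTwoAdditiveNeg{One,Two}SplitTwist` (irreducible `E[2]`, addL2x GEN 16) and
# `KatoMemberSharpAtTwoAdditiveNeg{One,Two}SplitTwistReducible` (reducible `E[2]`, k4-w3 GEN 0) RE-TYPED WITH THE IWASAWA-LEVEL
# INPUT AS A HYPOTHESIS — the conclusion of the cell's landed END theorems (`ℓ_𝔮(X(W/ℚ_∞)) ≤ ℓ_𝔮(Λ/(L̃))` at every height-one
# `𝔮 ∌ 2`, `ι L̃ = L⁻₂`, from the Literature construction fact `Kato2004.exists_splitTwistDivisibilityInputsDescent_negOne_two` + PRINT)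
# — so that what remains typed at `p = 2` on these blocks is EXACTLY the descent reading (T1–T14 / R1–R13·R12♯ + the new step T22
# at the exceptional prime); four `@[conjecture]` constants (MEMO tier, nothing asserted); Literature-only imports (importable by every
# route file and door; the pure-logic comparisons with the block targets live in `…AdditiveRankZeroResidualV12.lean`)

Seat `bsd-2adic-addL2x` GEN 18 (2026-08-29; repair-census entry R-B81 «descent socket», part 2 of 3; pattern of
`…AdditiveKatoTransportDefs.lean` (GEN 16) and `…AdditiveReducibleSplitTwistKatoMemberDefs.lean` (k4-w3 GEN 0); pen ruling RC-307 (β):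
statements at `p = 2` beyond the printed range are Summits-side `@[conjecture]` constants consumed BY NAME). HONEST FRAMING (cell
`bsd-2adic`, HUMAN RULING D-0036/D-0054): FOUR typed constants (nothing asserted), no theorem, no instance; types-the-object-of; closes
none; nothing booked; BSD is not proved by any of this. PARTITION: X5@2 additive potentially-multiplicative split-twist sub-blocks
((−1)-split 169 classes = 128 irreducible + 41 reducible `E[2]`; (−2)-split 39 = 30 + 9) × `p = 2`.

## Why sockets (the state after addL2x GEN 17 / k4-w3 GEN 8)

The residual of the crux BY NAME (`AddKatoTwo.additiveRankZeroAtTwo_of_residual_v11`, k4-w3 GEN 0) consumes on the four split-twist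
sub-blocks of the potentially multiplicative additive curves the four `@[conjecture]` block TARGETS `h₁ h₂ hR₁ hR₂` WHOLE. Their
docstrings (T20, R14) say they are «reading-grade modulo ONE object-level input at `2`» — the odd-branch §17.13 package. That input is
now the review-accepted Literature CONSTRUCTION fact `Kato2004.exists_splitTwistDivisibilityInputsDescent_negOne_two` (p724228; audit-2
sheet hDescTw PASS), and the cell's END theorems (`AddKatoTwo.katoDivisibility_negOneSplitTwist_two_of_descent_of_analyticRank_eq_zero`,
addL2x GEN 17, p727658; `…negTwoSplitTwist…`, k4-w3 GEN 8, p728952; `W`-only forms in `…AdditiveKatoDescentSocketDoors.lean`, GEN 18)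
derive from it + PRINT the Iwasawa-level statement

  (IW_d) for every cyclotomic `(κ, γ)` matching the cyclotomic variable and every newform `f` of `W^{(d)}`: `∃ L̃ ∈ Λ = ℤ₂⟦T⟧`,
  `ι L̃ = L⁻₂(f)` (`d = −1`: `padicLFunctionMinusBranchMult f 1 1`; `d = −2`: `padicLFunctionMinusBranchMultTwist f 1 1 (−1)`), `L̃ ≠ 0`,
  and `ℓ_𝔮(D.X) ≤ ℓ_𝔮(Λ/(L̃))` at every height-one `𝔮 ∌ 2` (i) for every key-`γ` dual Selmer datum `D` of `W`, (ii) for every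
  key-`γ⁻¹` datum, (iii) for every key-`γ` datum of every `W₁ ∼_ℚ W`

— but NO theorem connects (IW_d) to the block targets: the targets are the SHARP `2`-part of the Birch–Swinnerton-Dyer bound over `ℚ`,
and the passage from `X(W/ℚ_∞)` to `Ш(W/ℚ)` is Kato's descent (§14.14–Prop. 14.16) read at an additive `2` — the lane's reading T1–T14
(Literature facts `Kato2004/Additive*AtTwo*.lean`, D-audit PASS ×3), which on the split-twist blocks needs Conj. 12.10's inequality at
the ONE exceptional prime `𝔮₀` of (12.5.1) (T16–T18), where Thm. 12.5 (4) does not print it. The SOCKET of a block is its target with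
(IW_d) inserted as a hypothesis: it is implied by the target (`…_of_target` in `…AdditiveRankZeroResidualV12.lean` §0), it implies the
target GIVEN (IW_d) (the doors of `…AdditiveRankZeroResidualV12.lean` §1), and its content is the descent reading alone — T22 below shows how (IW_d) (ii) at `𝔮₀` IS
12.10's inequality at `𝔮₀`. After the sockets, the four split-twist sub-blocks read BY NAME «descent-reading socket + ONE Literature
construction fact + PRINT ×5 + KERNEL (+ (A) on the irreducible rows)», the same word as the (NST′) block's «reading
`hNST2`/`hinS` + PRINT (+ (A))».

## T22 — Conj. 12.10's inequality at the exceptional prime from (IW_d) (numbering continues T1–T21 of the lane; uses T15–T18 of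
## `Kato2004/AdditiveNoSplitCyclotomicTwistRankZeroShaUpperBoundFineSelmerAtTwoSharp.lean` /
## `…AdditiveNoSplitTwistNegOneRankZeroShaUpperBoundPlusOneAtTwo.lean` / `…AdditiveKatoPlusTwoDefs.lean`, T20 of
## `…AdditiveKatoTransportDefs.lean`, R14 of `…AdditiveReducibleSplitTwistKatoMemberDefs.lean`)

Setting: `W/ℚ` globally minimal, ADDITIVE at `2`, `W′ := W^{(−1)}` SPLIT multiplicative at `2` (the (−2)-block: `W^{(−2)}`, every
change listed in (e)), `L(W,1) ≠ 0`, `Ш(W/ℚ)` finite; `κ` THE cyclotomic `ℤ₂`-extension, `γ` a topological generator with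
`κ_cyc(γ) = 5` (every `ℚ_∞`-object is blind to the other lift class `γc̃`, `c̃` complex conjugation; the END theorems serve every
generator), `Λ' = ℤ₂⟦T⟧`, `1 + T ↦ γ`; `𝐇'^q = lim← H^q(ℤ_m[1/2], T₂W)` over the layers `ℚ_m` of `ℚ_∞` (T2/T11), `X = X(W/ℚ_∞)` in
its natural (key-`γ⁻¹`) `Λ'`-structure (species `W.SelmerDualData κ γ⁻¹`, the one for which (17.13.1) is `Λ'`-linear; RC-364 (1)
AP4), `𝔮₀ = (5T + 4) = (5(γ − 5⁻¹))` the exceptional prime of (12.5.1) for `f_W` (13.13 + Silverman *ATAEC* V.5.3: `V₂W|_{G_{ℚ₂}}`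
has the rank-one quotient `ℚ₂(κ⁻¹χ₋₁)`-twist; T16 (a)(b), T18 (a)), `L⁻ = L⁻₂(f′, 1, ω, T)` the odd branch of the one-term
Mazur–Tate–Teitelbaum measure of `f′ = f_{W′}` (`α = a₂(W′) = 1`; Kato Thm. 16.2), `L̃ ∈ Λ'` with `ι L̃ = L⁻` (it exists and is
`≠ 0`: kernel `exists_iwasawa_lift_oddBranch_ne_zero`, integrality + Rohrlich).

* **T22 (a) — at `𝔮₀`, (IW) (ii) IS Conj. 12.10's inequality for the transported zeta module.** Kato's Poitou–Tate sequence
  (17.13.1) for `f′` over his tower `K′_∞ = ℚ(ζ_{2^∞})` («exact upto `×2` in the case `p = 2`», p. 279 with 14.9), with (17.13.3) =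
  Greenberg LNM 1716 §2 at the split multiplicative place («for any algebraic extension», p. 81), descended on the ODD branch of
  `Δ = Gal(K′_∞/ℚ_∞) = {1, c}` (12.1; `T₂W = T₂W′ ⊗ χ₋₁`, so the `ℚ_∞`-objects of `W` are the `c = −1` parts of the `K′_∞`-objects of
  `W′`; all `Δ`-defects are killed by `2`) — i.e. EXACTLY the dictionary of the construction fact (its fields `loc, toX, δ, ε, upTo_*`,
  audit sheet hDescTw) read on Kato's GENUINE modules — gives, after localisation at the height-one prime `𝔮₀ ∌ 2`, an EXACT sequence
  `0 → (𝐇'¹/Z̃)_{𝔮₀} → (P⁻/Λ'·loc z̃)_{𝔮₀} → X_{𝔮₀} → 𝐇'²_{𝔮₀} → (𝐇'²_loc)_{𝔮₀} → 0`, where `Z̃ = Λ'·z̃`, `z̃ = cor(z_{γ′}(f′))` is the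
  transported zeta module (field `Z`; 12.6), `P⁻ = M/(c + 1)M` the odd descended singular quotient at `2` (`M = 𝐇¹_loc(T)/𝐇¹_loc(T′)`
  of the Tate curve `W′ ⊗ ℚ₂`, Lemma 17.12), the first map is injective because `𝐇'¹` is torsion-free of rank one (12.4 (2)) and
  `loc z̃ ≠ 0` (`G ≠ 0`), and the last map is onto at `𝔮₀` because the next Poitou–Tate term `(lim→_m H⁰(ℚ_m, W[2^∞]))^∨` is `0`
  for irreducible `W[2]` (T2) and a finite `2`-group otherwise. LENGTHS: (α) `(𝐇'²_loc)_{𝔮₀} ≅ Λ'/𝔮₀` has length `1` (13.13 +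
  (12.5.1), T16 (a)(b): the local term of Thm. 12.5 (3) for `f_W`). (β) `ℓ_{𝔮₀}(P⁻/Λ'·loc z̃) = 1 + ord_{𝔮₀} L⁻`: by the proof of
  Lemma 17.12 (p. 278: `M ↪ M₂ = 𝐇¹_loc(T″(k)) = lim←(K′_{n,w}^×)^∧ ⊃ U` the unit part, «`M₂/U ↪ ℤ_p` by the additive valuation»,
  `G`-invariant; Tate-untwisted the valuation line is `ℤ₂(−1)`: `c ↦ −1`, `γ ↦ 5⁻¹`) the valuation line SURVIVES on the odd branch as
  `Λ'/(γ − 5⁻¹) = Λ'/𝔮₀` and `π(M)` meets it with finite index (the connecting map `∂ : M₂ → 𝐇²_loc(T′(k)) ≅ ℤ₂` has image of finite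
  index and is non-zero on the `ζ`-system line `ℤ₂·u`, `u = (−ζ_{2ⁿ})_n` — (17.12.1) and the bridge (d) `log₂ q_{W′} ≠ 0` of the
  sibling fact — which lies on the EVEN branch; so `M₂ ⊇ π(M) ⊕ ℤ₂u` with finite index), whence `(P⁻)_{𝔮₀}` is free of rank one over
  the discrete valuation ring `Λ'_{𝔮₀}` with `(U⁻)_{𝔮₀} = 𝔮₀·(P⁻)_{𝔮₀}` and Kato's map `b` (`= 𝔏_η` on the unit part, Thm. 16.4 /
  bridges (a)–(c)) an isomorphism `(U⁻)_{𝔮₀} ≅ Λ'_{𝔮₀}` (its kernel `ℤ₂u` and cokernel are even-branch); and `θ·loc z̃ ∈ U⁻`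
  (`θ = 5T + 4`, field `theta_mem_U`) with `pr⁻(b(π(θ·m))) = pr⁻(𝔏_η(θ·z)) ≐ 2ⁿ·θ·L⁻` (Thm. 16.6 (2) for `f′`, `Λ_G`-linearity,
  `pr⁻(L_{p-adic}(f′)) = L⁻`; field `G_mem_and_ne_zero`). Writing `loc z̃ = θ^k·e` with `e` a generator of `(P⁻)_{𝔮₀}`:
  `b(θ·loc z̃) = θ^k·b(θe)`, `b(θe)` a unit, so `θ^k ≐ θ·L⁻` at `𝔮₀`, `k = 1 + ord_{𝔮₀} L⁻`. (γ) The alternating sum: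
  `ℓ_{𝔮₀}(X) + ℓ_{𝔮₀}(𝐇'¹/Z̃) = ℓ_{𝔮₀}(P⁻/Λ'loc z̃) − ℓ_{𝔮₀}(𝐇'²_loc) + ℓ_{𝔮₀}(𝐇'²) = ord_{𝔮₀} L⁻ + ℓ_{𝔮₀}(𝐇'²)` — the local term
  and the Coleman excess CANCEL (the algebra is the cell's PROVED `Kato2004.lengthAt_add_eq_of_skeleton_exceptional`, GEN 15 p662844).
  Hence **(IW) (ii) at `𝔮₀`, `ℓ_{𝔮₀}(X) ≤ ℓ_{𝔮₀}(Λ'/(L̃)) = ord_{𝔮₀} L⁻`, is EQUIVALENT to `ℓ_{𝔮₀}(𝐇'²) ≤ ℓ_{𝔮₀}(𝐇'¹/Z̃)`.**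
* **T22 (b) — `Z̃` and Kato's `Z(f_W)` agree at every height-one prime away from `2`.** `𝐇'¹(V₂W)` is free of rank one over
  `Λ' ⊗ ℚ` (12.4 (2), T2), and `z` (the image of Kato's `z_γ(f_W)`, `γ ∈ V_ℤ(f_W)`, 13.9/T9) and `z̃` are non-zero in it (12.5 (2);
  `G ≠ 0`), so `z̃ = h·z` with `h ∈ Frac(Λ')`. Thm. 12.5 (1) for `f_W` and for `f′`, at a character `ψ` of `Γ_n = Gal(ℚ_n/ℚ)` (an
  EVEN character of `G_{n+2} = Δ × Γ_n`) resp. at `ωψ`, computes the `ψ`-component of `exp*` of the layer-`n` classes: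
  `L_{(2)}(f_W, ψ, 1)·per_{f_W}(γ)^{+}` resp. `L_{(2)}(f′, ωψ, 1)·per_{f′}(γ′)^{−}`; and `L(f′, ωψ, s) = L(f_W, ψ, s)` (`f_W = f′ ⊗ ω`;
  the Euler factors at `2` are `1` on both sides for `ψ ≠ 1`), so `h(ψ)·c_W = c_{W′}` with the two period constants
  `c_W = per⁺_{f_W}(γ)`, `c_{W′} = per⁻_{f′}(γ′)` (only EVEN `ψ` occur on the `Γ`-tower, so ONE ratio) for every `ψ` of `2`-power
  conductor with `L(W, ψ, 1) ≠ 0` — all but finitely many (Rohrlich). A non-zero element of `Frac(Λ')` has finitely many zeros in the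
  open unit disc (Weierstrass preparation, Washington §7.1), so `h = c_{W′}/c_W` is CONSTANT, a unit of `Λ'_𝔮` at every height-one
  `𝔮 ∌ 2`: `Λ'_𝔮·z̃ = Λ'_𝔮·z`, and `ℓ_𝔮(𝐇'¹/Z̃) = ℓ_𝔮(𝐇'¹/Z(f_W,T₂W))` there (12.6: `Z ⊂ Z(f,T)` of `2`-power index). With (a):
  **Conj. 12.10's inequality at `𝔮₀` for `(𝐇'²(T₂W), 𝐇'¹(T₂W)/Z(f_W))` — the ONE input of step T3 at the ONE `e₊`-prime where Thm.
  12.5 (4) does not print it (T16 (c), T18 (a)) — FOLLOWS from (IW) (ii).**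
* **T22 (c) — the count.** T1–T14 / T1′–T7′ VERBATIM (as recorded in the (NST′) facts: nothing else sees the reduction type over
  the layers, T16 (d)), T3 now holding at EVERY `e₊`-prime: TOTAL `ord₂ #Ш(W)[2^∞] + Σ_ℓ v₂(c_ℓ) ≤ ord₂(L(W,1)/Ω_W)` — the `+2` of T18
  ((−1)-block) and the `+1` of T17 ((−2)-block) are gone. This is the conclusion of the irreducible sockets §1.
* **T22 (d) — the member (reducible `E[2]`) blocks.** R14 (a)–(d) VERBATIM with R8 at `𝔮₀` supplied by (a)+(b) at the member's
  lattice — lattice-free (R14 (b)); (IW) (iii) even serves every `W₁ ∼_ℚ W` directly; statement (A) at `(W_K, 2)` is PRINT there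
  (Lim 3.5@2 + Ferrero–Washington), so the member sockets §2 carry no (A) binder, exactly as `hR₁`/`hR₂`.
* **T22 (e) — the (−2)-block.** `W″ = W^{(−2)}`, `F = ℚ(√−2)`, `𝔮₀ = (5T + 6)`, `L⁻ ↦ L⁻₂(f″, 1, ω·χ₂, T) =
  padicLFunctionMinusBranchMultTwist f″ 1 1 (−1)` (the cell's kernel `Γ`-twist transport R15 / `AddKatoTwoGammaTwist.…`, k4-w3
  GEN 1–8, carries the (−1) package to the (−2) package; END theorem p728952); (a)–(d) word for word.
* **Status / WHAT IS NOT CLAIMED.** T22 (a)(b) are READINGS of Kato's printed statements at `p = 2` on GENUINE modules ((17.13.1)/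
  (17.13.3) and Lemma 17.12's objects for the Tate curve at `2` on the odd branch — the construction fact's own dictionary, there stated
  for an abstract `H2`; 12.4 (2), 12.5 (1)(2), 12.6, 13.13 with (12.5.1), 16.4, 16.6 (2) — printed for every `f` resp. under §16.1 with
  `α = 1`; Rohrlich; Weierstrass preparation), not kernel theorems — whence the `@[conjecture]` tag (RC-307 (β)); the sockets are
  WEAKER than the block targets they replace (v12 §0) and say nothing when (IW_d) fails; nothing for CM, analytic rank `1`, lower bounds;
  statement (A) stays a hypothesis of the irreducible sockets; the sockets do not assert (IW_d).

References: [Kato2004Asterisque] 12.1 (pp. 219–220), Thm. 12.4 (2) (p. 221), Thm. 12.5 (1)–(4) with (12.5.1) (pp. 221–222), Thm. 12.6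
(p. 222), Conj. 12.10 (p. 224), 13.9 (pp. 229–230), 13.13 (pp. 233–234), 14.9 (p. 239), §14.14–Lemma 14.15 (pp. 243–244), Prop. 14.16 (2)
(pp. 244–245), Thm. 16.2, 16.4, 16.6 (pp. 268–271), Lemma 17.12 with (17.12.1) (pp. 278–279), §17.13 (17.13.1)–(17.13.3) (pp. 279–280);
[GreenbergLNM1716] Thm. 1.14 (p. 68), §2 (pp. 81–82), Lemma 4.2; [Rohrlich1984] Theorem; [Washington1997] §7.1, §13.2;
[MazurTateTeitelbaum1986Invent] §I.10–I.14, §I.17; [SilvermanATAEC1994] Lemma V.5.2, Thm. V.5.3, Ex. 5.11; [CoatesSujatha2005]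
statement (A); [Lim2017FineSelmer] Thm. 3.5; [FerreroWashington1979]; tree `Kato2004/DivisibilityInputsSplitTwistDescent{,TransportProofs}.lean`
(p724228/p725170), `Kato2004/ZetaIndexInequalityExceptionalPrimeProofs.lean` (p662844), the END files
`…AdditiveKatoTransportDescent{,NegTwo}FinalDoors.lean` (p727658/p728952); memo `run/shared/lean/pub/bsd-2adic/addL2x/VERDICT-19098-addL2x-GEN18.md`.
-/

set_option autoImplicit false
-- the summit's namespace `Summit.BirchSwinnertonDyer.BirchSwinnertonDyer` (Sub = Summit) trips `dupNamespace`
set_option linter.dupNamespace false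

noncomputable section

open scoped Classical MatrixGroups ModularForm

open Field CongruenceSubgroup WeierstrassCurve Literature.NumberTheory.EllipticCurves
  Literature.NumberTheory.EllipticCurves.ModularForms Literature.NumberTheory.EllipticCurves.Module

namespace Summit.BirchSwinnertonDyer.BirchSwinnertonDyer.Theorems.AddKatoTwo

/-! ## §1 The irreducible sockets: `KatoSharpAtTwoAdditiveNeg{One,Two}SplitTwist` with (IW_d) as a hypothesis -/

/-- [crux, MEMO] **The DESCENT SOCKET of the additive (−1)-split-twist block with IRREDUCIBLE `E[2]`** (128 X5@2 classes): the block
target `KatoSharpAtTwoAdditiveNegOneSplitTwist` (addL2x GEN 16) VERBATIM with the Iwasawa-level input (IW₋₁) inserted as a hypothesis —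
for every globally minimal non-CM `W/ℚ` ADDITIVE at `2` with `W^{(−1)}` SPLIT multiplicative at `2`, `E[2]` irreducible, statement (A)
at `(E,2)`, `L(W,1) ≠ 0`, `Ш(W/ℚ)` finite, IF for every cyclotomic `(κ, γ)` matching the cyclotomic variable and every newform `f` of
`W^{(−1)}` there is `L̃ ∈ Λ` with `ι L̃ = L⁻₂(f, 1, ω, T)`, `L̃ ≠ 0` and `ℓ_𝔮(X(W/ℚ_∞)) ≤ ℓ_𝔮(Λ/(L̃))` at every height-one `𝔮 ∌ 2`
(key `γ`, key `γ⁻¹`, every `W₁ ∼_ℚ W` — VERBATIM the conclusion of `katoDivisibility_negOneSplitTwist_two_of_descent_of_L_one_ne_zero`,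
which DERIVES it from the Literature construction fact `Kato2004.exists_splitTwistDivisibilityInputsDescent_negOne_two` + PRINT), THEN
`L(W,1)/Ω(W) = q ∈ ℚ` with `ord₂ #Ш(W)(2) + v₂(Tam(W)) ≤ ord₂ q`. CONTENT = the descent reading ALONE: T1–T14 / T1′–T7′ of the
(NST′) facts with the ONE input of step T3 at the exceptional prime `𝔮₀ = (5T+4)` of (12.5.1) — Conj. 12.10's inequality there —
obtained from the hypothesis by T22 (a)(b) of the module docstring (Kato's (17.13.1) on the odd branch + Lemma 17.12's valuation line +
13.13 + 12.4 (2) / 12.5 (1)(2) / Rohrlich). Strictly WEAKER than the block target (`katoDescentSocketAtTwoAdditiveNegOneSplitTwist_of_target`, v12 §0);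
with (IW₋₁) it gives the target back (door in `…AdditiveRankZeroResidualV12.lean`). STATUS: `@[conjecture]` per RC-307 (β) (a reading at
`p = 2`, MEMO tier). WHAT IS NOT CLAIMED: the statement itself; (IW₋₁) (a hypothesis); (A) (a hypothesis); anything for reducible
`E[2]` (§2), CM, analytic rank `1`; lower bounds.
[cite: Kato2004Asterisque, Thm. 12.4 (2) (p. 221), Thm. 12.5 (1)–(4) and (12.5.1) (pp. 221–222), Thm. 12.6 (p. 222), Conj. 12.10 (p. 224), 13.13 (pp. 233–234), 14.9 (p. 239), §14.14 and Lemma 14.15 (pp. 243–244), Prop. 14.16 (2) (pp. 244–245), Thm. 16.4 and 16.6 (2) (pp. 270–271), Lemma 17.12 with (17.12.1) (pp. 278–279), §17.13 (17.13.1)–(17.13.3) (pp. 279–280)]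
[cite: GreenbergLNM1716, §2 (pp. 81–82) and Lemma 4.2] [cite: Rohrlich1984, Theorem] [cite: Washington1997, §7.1]
[cite: CoatesSujatha2005, statement (A) (the hypothesis)] [cite: SilvermanATAEC1994, Thm. V.5.3 and Ex. 5.11] -/
@[conjecture] def KatoDescentSocketAtTwoAdditiveNegOneSplitTwist : Prop :=
  ∀ (W : WeierstrassCurve ℚ) [W.IsElliptic] [W.IsGloballyMinimal], ¬ W.HasCM →
    ¬ W.HasGoodReductionAtPrime 2 → ¬ W.HasMultiplicativeReductionAtPrime 2 →
    (W.quadraticTwist (-1)).HasSplitMultiplicativeReductionAtPrime 2 →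
    W.HasIrreducibleModPGaloisRep 2 →
    (∀ (κ : ZpExtension ℚ 2), κ.IsCyclotomic →
      ∃ (γ : Field.absoluteGaloisGroup ℚ) (D : W.FineSelmerDualData κ γ),
        Module.Finite ℤ_[2] (RestrictScalars ℤ_[2] (IwasawaAlgebra 2) D.X)) →
    W.entireLFunction 1 ≠ 0 → Finite W.sha →
    (∀ (κ : ZpExtension ℚ 2) (γ : absoluteGaloisGroup ℚ), κ.IsCyclotomic → κ.IsTopGenerator γ →
      IsCyclotomicVariable 2 γ → ∀ {N : ℕ} [NeZero N] (f : CuspForm (Gamma0 N) 2),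
      IsNewformOf (W.quadraticTwist (-1)) f →
      ∃ Lt : IwasawaAlgebra 2, iwasawaToPowerSeries 2 Lt = padicLFunctionMinusBranchMult f (1 : ℚ_[2]) 1 ∧ Lt ≠ 0 ∧
        (∀ (D : W.SelmerDualData κ γ) (𝔮 : PrimeSpectrum (IwasawaAlgebra 2)), 𝔮.asIdeal.height = 1 →
          PowerSeries.C (2 : ℤ_[2]) ∉ 𝔮.asIdeal →
          lengthAt (IwasawaAlgebra 2) D.X 𝔮 ≤ lengthAt (IwasawaAlgebra 2) (IwasawaAlgebra 2 ⧸ Ideal.span {Lt}) 𝔮) ∧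
        (∀ (D' : W.SelmerDualData κ γ⁻¹) (𝔮 : PrimeSpectrum (IwasawaAlgebra 2)), 𝔮.asIdeal.height = 1 →
          PowerSeries.C (2 : ℤ_[2]) ∉ 𝔮.asIdeal →
          lengthAt (IwasawaAlgebra 2) D'.X 𝔮 ≤ lengthAt (IwasawaAlgebra 2) (IwasawaAlgebra 2 ⧸ Ideal.span {Lt}) 𝔮) ∧
        (∀ (W₁ : WeierstrassCurve ℚ) [W₁.IsElliptic], IsIsogenous W W₁ →
          ∀ (D₁ : W₁.SelmerDualData κ γ) (𝔮 : PrimeSpectrum (IwasawaAlgebra 2)), 𝔮.asIdeal.height = 1 →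
          PowerSeries.C (2 : ℤ_[2]) ∉ 𝔮.asIdeal →
          lengthAt (IwasawaAlgebra 2) D₁.X 𝔮 ≤ lengthAt (IwasawaAlgebra 2) (IwasawaAlgebra 2 ⧸ Ideal.span {Lt}) 𝔮)) →
    ∃ q : ℚ, W.entireLFunction 1 / (W.realPeriodRat : ℂ) = (q : ℂ) ∧
      (padicValNat 2 (Nat.card (AddCommGroup.primaryComponent W.sha 2)) : ℤ) +
          padicValNat 2 W.tamagawaProduct ≤ padicValRat 2 q

/-- [crux, MEMO] **The DESCENT SOCKET of the additive (−2)-split-twist block with IRREDUCIBLE `E[2]`** (30 X5@2 classes): the block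
target `KatoSharpAtTwoAdditiveNegTwoSplitTwist` VERBATIM with (IW₋₂) inserted as a hypothesis — (IW₋₂) = VERBATIM the conclusion of
`katoDivisibility_negTwoSplitTwist_two_of_descent_of_L_one_ne_zero` (k4-w3's END p728952 in `W`-only form: the `ω·χ₂`-branch
`padicLFunctionMinusBranchMultTwist f 1 1 (−1)` for a newform `f` of `W^{(−2)}`). CONTENT = T22 (e): the same descent reading with
`F = ℚ(√−2)`, `𝔮₀ = (5T+6)`. Strictly weaker than the target; with (IW₋₂) it gives the target back. STATUS / NOT CLAIMED: as
`KatoDescentSocketAtTwoAdditiveNegOneSplitTwist`.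
[cite: Kato2004Asterisque, Thm. 12.4 (2) (p. 221), Thm. 12.5 (1)–(4) and (12.5.1) (pp. 221–222), Conj. 12.10 (p. 224), 13.13 (pp. 233–234), §14.14 and Lemma 14.15 (pp. 243–244), Prop. 14.16 (2) (pp. 244–245), Thm. 16.6 (2) (p. 271), Lemma 17.12 (pp. 278–279), §17.13 (pp. 279–280)]
[cite: GreenbergLNM1716, §2 (pp. 81–82)] [cite: MazurTateTeitelbaum1986Invent, §I.12–I.14 and §I.17] [cite: Rohrlich1984, Theorem]
[cite: CoatesSujatha2005, statement (A) (the hypothesis)] -/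
@[conjecture] def KatoDescentSocketAtTwoAdditiveNegTwoSplitTwist : Prop :=
  ∀ (W : WeierstrassCurve ℚ) [W.IsElliptic] [W.IsGloballyMinimal], ¬ W.HasCM →
    ¬ W.HasGoodReductionAtPrime 2 → ¬ W.HasMultiplicativeReductionAtPrime 2 →
    (W.quadraticTwist (-2)).HasSplitMultiplicativeReductionAtPrime 2 →
    W.HasIrreducibleModPGaloisRep 2 →
    (∀ (κ : ZpExtension ℚ 2), κ.IsCyclotomic →
      ∃ (γ : Field.absoluteGaloisGroup ℚ) (D : W.FineSelmerDualData κ γ),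
        Module.Finite ℤ_[2] (RestrictScalars ℤ_[2] (IwasawaAlgebra 2) D.X)) →
    W.entireLFunction 1 ≠ 0 → Finite W.sha →
    (∀ (κ : ZpExtension ℚ 2) (γ : absoluteGaloisGroup ℚ), κ.IsCyclotomic → κ.IsTopGenerator γ →
      IsCyclotomicVariable 2 γ → ∀ {N : ℕ} [NeZero N] (f : CuspForm (Gamma0 N) 2),
      IsNewformOf (W.quadraticTwist (-2)) f →
      ∃ Lt : IwasawaAlgebra 2,
        iwasawaToPowerSeries 2 Lt = padicLFunctionMinusBranchMultTwist f (1 : ℚ_[2]) 1 (-1) ∧ Lt ≠ 0 ∧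
        (∀ (D : W.SelmerDualData κ γ) (𝔮 : PrimeSpectrum (IwasawaAlgebra 2)), 𝔮.asIdeal.height = 1 →
          PowerSeries.C (2 : ℤ_[2]) ∉ 𝔮.asIdeal →
          lengthAt (IwasawaAlgebra 2) D.X 𝔮 ≤ lengthAt (IwasawaAlgebra 2) (IwasawaAlgebra 2 ⧸ Ideal.span {Lt}) 𝔮) ∧
        (∀ (D' : W.SelmerDualData κ γ⁻¹) (𝔮 : PrimeSpectrum (IwasawaAlgebra 2)), 𝔮.asIdeal.height = 1 →
          PowerSeries.C (2 : ℤ_[2]) ∉ 𝔮.asIdeal →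
          lengthAt (IwasawaAlgebra 2) D'.X 𝔮 ≤ lengthAt (IwasawaAlgebra 2) (IwasawaAlgebra 2 ⧸ Ideal.span {Lt}) 𝔮) ∧
        (∀ (W₁ : WeierstrassCurve ℚ) [W₁.IsElliptic], IsIsogenous W W₁ →
          ∀ (D₁ : W₁.SelmerDualData κ γ) (𝔮 : PrimeSpectrum (IwasawaAlgebra 2)), 𝔮.asIdeal.height = 1 →
          PowerSeries.C (2 : ℤ_[2]) ∉ 𝔮.asIdeal →
          lengthAt (IwasawaAlgebra 2) D₁.X 𝔮 ≤ lengthAt (IwasawaAlgebra 2) (IwasawaAlgebra 2 ⧸ Ideal.span {Lt}) 𝔮)) →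
    ∃ q : ℚ, W.entireLFunction 1 / (W.realPeriodRat : ℂ) = (q : ℂ) ∧
      (padicValNat 2 (Nat.card (AddCommGroup.primaryComponent W.sha 2)) : ℤ) +
          padicValNat 2 W.tamagawaProduct ≤ padicValRat 2 q

/-! ## §2 The member sockets: `KatoMemberSharpAtTwoAdditiveNeg{One,Two}SplitTwistReducible` with (IW_d) as a hypothesis -/

/-- [crux, MEMO] **The DESCENT SOCKET of the additive (−1)-split-twist block with REDUCIBLE `E[2]`** (41 X5@2 classes): k4-w3's block
target `KatoMemberSharpAtTwoAdditiveNegOneSplitTwistReducible` VERBATIM with (IW₋₁) (as in §1) inserted as a hypothesis — the MEMBER-SHARP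
bound `ord₂ #Ш(W_K)(2) + v₂(Tam(W_K)) ≤ ord₂(L(W_K,1)/Ω(W_K)) + 2·ord₂ #W_K(ℚ)_tors` at some globally minimal `W_K ∼_ℚ W`. CONTENT =
T22 (d): R1–R13·R12♯ (Literature facts `Kato2004/MemberHullInputsTwo*.lean`, D-audit PASS) with R8 at `𝔮₀` from (IW₋₁) by T22 (a)(b)
— lattice-free (R14 (b)); (IW₋₁) (iii) serves every `W₁ ∼_ℚ W` — and (A) at `(W_K,2)` PRINT (Lim 3.5@2 + Ferrero–Washington). Strictly
weaker than the target; with (IW₋₁) it gives the target back. STATUS / NOT CLAIMED: as §1; which curve `W_K` is; the equality form.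
[cite: Kato2004Asterisque, Thm. 12.4 (2) (p. 221), Thm. 12.5 (1)–(4) and (12.5.1) (pp. 221–222), Thm. 12.6 (p. 222), Conj. 12.10 (p. 224), 13.13 (pp. 233–234), §14.14 and Lemma 14.15 (pp. 243–244), Prop. 14.16 (2) and its proof (pp. 244–245), Lemma 17.12 (pp. 278–279), §17.13 (pp. 279–280)]
[cite: GreenbergLNM1716, §2 (pp. 81–82)] [cite: MazurRubin2004, Thm. 2.3.4] [cite: Lim2017FineSelmer, §3 Thm. 3.5] [cite: FerreroWashington1979, Theorem]
[cite: Rohrlich1984, Theorem] -/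
@[conjecture] def KatoDescentSocketAtTwoAdditiveNegOneSplitTwistReducible : Prop :=
  ∀ (W : WeierstrassCurve ℚ) [W.IsElliptic] [W.IsGloballyMinimal], ¬ W.HasCM →
    ¬ W.HasGoodReductionAtPrime 2 → ¬ W.HasMultiplicativeReductionAtPrime 2 →
    (W.quadraticTwist (-1)).HasSplitMultiplicativeReductionAtPrime 2 →
    ¬ W.HasIrreducibleModPGaloisRep 2 →
    W.entireLFunction 1 ≠ 0 → Finite W.sha →
    (∀ (κ : ZpExtension ℚ 2) (γ : absoluteGaloisGroup ℚ), κ.IsCyclotomic → κ.IsTopGenerator γ →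
      IsCyclotomicVariable 2 γ → ∀ {N : ℕ} [NeZero N] (f : CuspForm (Gamma0 N) 2),
      IsNewformOf (W.quadraticTwist (-1)) f →
      ∃ Lt : IwasawaAlgebra 2, iwasawaToPowerSeries 2 Lt = padicLFunctionMinusBranchMult f (1 : ℚ_[2]) 1 ∧ Lt ≠ 0 ∧
        (∀ (D : W.SelmerDualData κ γ) (𝔮 : PrimeSpectrum (IwasawaAlgebra 2)), 𝔮.asIdeal.height = 1 →
          PowerSeries.C (2 : ℤ_[2]) ∉ 𝔮.asIdeal →
          lengthAt (IwasawaAlgebra 2) D.X 𝔮 ≤ lengthAt (IwasawaAlgebra 2) (IwasawaAlgebra 2 ⧸ Ideal.span {Lt}) 𝔮) ∧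
        (∀ (D' : W.SelmerDualData κ γ⁻¹) (𝔮 : PrimeSpectrum (IwasawaAlgebra 2)), 𝔮.asIdeal.height = 1 →
          PowerSeries.C (2 : ℤ_[2]) ∉ 𝔮.asIdeal →
          lengthAt (IwasawaAlgebra 2) D'.X 𝔮 ≤ lengthAt (IwasawaAlgebra 2) (IwasawaAlgebra 2 ⧸ Ideal.span {Lt}) 𝔮) ∧
        (∀ (W₁ : WeierstrassCurve ℚ) [W₁.IsElliptic], IsIsogenous W W₁ →
          ∀ (D₁ : W₁.SelmerDualData κ γ) (𝔮 : PrimeSpectrum (IwasawaAlgebra 2)), 𝔮.asIdeal.height = 1 →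
          PowerSeries.C (2 : ℤ_[2]) ∉ 𝔮.asIdeal →
          lengthAt (IwasawaAlgebra 2) D₁.X 𝔮 ≤ lengthAt (IwasawaAlgebra 2) (IwasawaAlgebra 2 ⧸ Ideal.span {Lt}) 𝔮)) →
    ∃ (W' : WeierstrassCurve ℚ) (_ : W'.IsElliptic) (_ : W'.IsGloballyMinimal),
      IsIsogenous W W' ∧ Finite W'.sha ∧
      ∃ q : ℚ, W'.entireLFunction 1 / (W'.realPeriodRat : ℂ) = (q : ℂ) ∧
        (padicValNat 2 (Nat.card (AddCommGroup.primaryComponent W'.sha 2)) : ℤ) +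
            padicValNat 2 W'.tamagawaProduct ≤
          padicValRat 2 q + 2 * (padicValNat 2 W'.torsionOrder : ℤ)

/-- [crux, MEMO] **The DESCENT SOCKET of the additive (−2)-split-twist block with REDUCIBLE `E[2]`** (9 X5@2 classes): k4-w3's block
target `KatoMemberSharpAtTwoAdditiveNegTwoSplitTwistReducible` VERBATIM with (IW₋₂) (as in §1) inserted as a hypothesis. CONTENT =
T22 (d)(e). Strictly weaker than the target; with (IW₋₂) it gives the target back. STATUS / NOT CLAIMED: as above.
[cite: Kato2004Asterisque, Thm. 12.5 (1)–(4) and (12.5.1) (pp. 221–222), Conj. 12.10 (p. 224), 13.13 (pp. 233–234), Prop. 14.16 (2) and its proof (pp. 244–245), Thm. 16.6 (2) (p. 271), Lemma 17.12 (pp. 278–279), §17.13 (pp. 279–280)]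
[cite: GreenbergLNM1716, §2 (pp. 81–82)] [cite: MazurTateTeitelbaum1986Invent, §I.12–I.14 and §I.17] [cite: MazurRubin2004, Thm. 2.3.4]
[cite: Lim2017FineSelmer, §3 Thm. 3.5] [cite: FerreroWashington1979, Theorem] -/
@[conjecture] def KatoDescentSocketAtTwoAdditiveNegTwoSplitTwistReducible : Prop :=
  ∀ (W : WeierstrassCurve ℚ) [W.IsElliptic] [W.IsGloballyMinimal], ¬ W.HasCM →
    ¬ W.HasGoodReductionAtPrime 2 → ¬ W.HasMultiplicativeReductionAtPrime 2 →
    (W.quadraticTwist (-2)).HasSplitMultiplicativeReductionAtPrime 2 →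
    ¬ W.HasIrreducibleModPGaloisRep 2 →
    W.entireLFunction 1 ≠ 0 → Finite W.sha →
    (∀ (κ : ZpExtension ℚ 2) (γ : absoluteGaloisGroup ℚ), κ.IsCyclotomic → κ.IsTopGenerator γ →
      IsCyclotomicVariable 2 γ → ∀ {N : ℕ} [NeZero N] (f : CuspForm (Gamma0 N) 2),
      IsNewformOf (W.quadraticTwist (-2)) f →
      ∃ Lt : IwasawaAlgebra 2,
        iwasawaToPowerSeries 2 Lt = padicLFunctionMinusBranchMultTwist f (1 : ℚ_[2]) 1 (-1) ∧ Lt ≠ 0 ∧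
        (∀ (D : W.SelmerDualData κ γ) (𝔮 : PrimeSpectrum (IwasawaAlgebra 2)), 𝔮.asIdeal.height = 1 →
          PowerSeries.C (2 : ℤ_[2]) ∉ 𝔮.asIdeal →
          lengthAt (IwasawaAlgebra 2) D.X 𝔮 ≤ lengthAt (IwasawaAlgebra 2) (IwasawaAlgebra 2 ⧸ Ideal.span {Lt}) 𝔮) ∧
        (∀ (D' : W.SelmerDualData κ γ⁻¹) (𝔮 : PrimeSpectrum (IwasawaAlgebra 2)), 𝔮.asIdeal.height = 1 →
          PowerSeries.C (2 : ℤ_[2]) ∉ 𝔮.asIdeal →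
          lengthAt (IwasawaAlgebra 2) D'.X 𝔮 ≤ lengthAt (IwasawaAlgebra 2) (IwasawaAlgebra 2 ⧸ Ideal.span {Lt}) 𝔮) ∧
        (∀ (W₁ : WeierstrassCurve ℚ) [W₁.IsElliptic], IsIsogenous W W₁ →
          ∀ (D₁ : W₁.SelmerDualData κ γ) (𝔮 : PrimeSpectrum (IwasawaAlgebra 2)), 𝔮.asIdeal.height = 1 →
          PowerSeries.C (2 : ℤ_[2]) ∉ 𝔮.asIdeal →
          lengthAt (IwasawaAlgebra 2) D₁.X 𝔮 ≤ lengthAt (IwasawaAlgebra 2) (IwasawaAlgebra 2 ⧸ Ideal.span {Lt}) 𝔮)) →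
    ∃ (W' : WeierstrassCurve ℚ) (_ : W'.IsElliptic) (_ : W'.IsGloballyMinimal),
      IsIsogenous W W' ∧ Finite W'.sha ∧
      ∃ q : ℚ, W'.entireLFunction 1 / (W'.realPeriodRat : ℂ) = (q : ℂ) ∧
        (padicValNat 2 (Nat.card (AddCommGroup.primaryComponent W'.sha 2)) : ℤ) +
            padicValNat 2 W'.tamagawaProduct ≤
          padicValRat 2 q + 2 * (padicValNat 2 W'.torsionOrder : ℤ)

end Summit.BirchSwinnertonDyer.BirchSwinnertonDyer.Theorems.AddKatoTwo

end
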